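import Summits.QuantumFields.QCD.Theses.TransparentRPWall
import Summits.QuantumFields.QCD.Theses.FourMirrorsWardE1
import Summits.QuantumFields.QCD.Theses.GapBuysCauchyRate
import Summits.QuantumFields.QCD.Theorems.GapBuysCauchyRateCauchySummation
import Summits.QuantumFields.QCD.Theorems.GapBuysCauchyRateConvergentOSClosureStubSoftClosure
import Summits.QuantumFields.QCD.Theorems.GapBuysCauchyRateConvergentOSClosureStubAsymptoticTranslation
import Summits.QuantumFields.QCD.Theorems.GapBuysCauchyRateRotationRestorationLatticeInvariancePassesToLimit
import HarnessLib

/-!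
# Skeleton for crux `HonestLatticeLimit` (item stmt-QuantumFields-18092), line `ladder_bridge`
(strategist ALTERNATIVE line — NOT registered over the live skeleton `Cruxes/QCDHypercubicLimit/Lines/split.lean`)

Routes `route-QuantumFields-FourMirrorsWardE1` (bet) and `route-QuantumFields-TransparentRPWall`; crux decl
`Summit.QuantumFields.QCD.Theses.TransparentRPWall.HonestLatticeLimit` (the `FourMirrorsWardE1` copy has the identical
body; both conclusions are derived below).  Author `planner-cstrat-stmt-QuantumFields-18092-s1-0`, 2026-08-17.

## Idea (the LADDER BRIDGE)

`HonestLatticeLimit` (X₁) is the line-neutral EXISTENCE half of QCD: one mass-scaling, chiral-at-zero regularisation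
whose honest lattice `n`-point functions converge for every positive mass tuple to a normalised, E0′, symmetric,
translation- and hypercubically-invariant family on `⁰𝒮` with a uniform lattice gap, non-trivial (glue, `pseudoRe f g`)
and non-Gaussian (glue).  The live skeleton `split` asks for this through ONE monolithic lattice stub (A) in an ad hoc
currency.  This line instead routes X₁ through the typed, STAFFED existence programme of the sibling route
`GapBuysCauchyRate`, whose lattice-package toolkit is landed (`qcdLatticeDist`, off-diagonal tensor density,
Hahn–Banach limit families, inheritance of E0/E0′/E1-translations/E3, calibrated one-point subtraction):

* `stub_ladderCauchyRate` (LCR) — VERBATIM the open crux `GapBuysCauchyRate.LadderCauchyRate`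
  (item stmt-QuantumFields-17307, rank 2, staffed): a calibrated ladder, chiral at zero, gapped, calibration biting,
  `κ₃` floor, and CAUCHY with a summable envelope (full-sequence convergence — no sub-ladder, hence no stable
  chirality / mass-equicontinuity is needed, which is where `split`'s stub (A) is stuck);
* `stub_calibratedTightness` (T) — VERBATIM the open registered stub `stub_tightness` of the sibling crux
  `ConvergentOSClosure` (stmt-QuantumFields-11525, `Cruxes/ConvergentOSClosure/Lines/registered.lean`): the k-uniform
  E0′ bound on `⁰𝒮` (UV tightness) along a convergent calibrated gapped AF ladder;
* `stub_discreteRemnant` (HYP, new, provable with work) — the hypercubic REMNANT of Euclidean invariance: along the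
  same ladder, GIVEN the E0′ bound, the canonical lattice distributions become invariant under every proper signed
  permutation of the axes (the 192-element rotation subgroup of the hypercubic group) on `⁰𝒮`.  Axis PERMUTATIONS are an
  exact symmetry of the honest functional (tree: `qcdTorusExpect_quarkAxisPerm`, landed `stub_latticePermCovariance`
  for even ones); axis REFLECTIONS `x_μ ↦ −x_μ` (spinor twist `γ_μ γ₅`, link reversal) are exact for the quark bilinears
  but move the forward-plaquette glue density `∑_{i<j} Re tr U_{p_ij}(x)` by one lattice unit in the reflected
  directions, so the statement is ASYMPTOTIC and uses the E0′ equicontinuity exactly as the landed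
  `stub_asymptoticTranslation` does (Montvay–Münster 1994 §4.2, p. 75 of the held copy: "symmetric under reflections in
  lattice planes and under rotations by π/2").

The composition `HonestLatticeLimit_of : LCR → T → HYP → HonestLatticeLimit` is kernel-checked below with NO sorry
outside the three stubs: Cauchy + summable ⇒ convergence on real tensors (landed `cauchySummation_proof`); T ⇒ E0′
bound; landed AT ⇒ asymptotic translations; HYP ⇒ asymptotic hypercubic invariance; density of off-diagonal tensors +
equicontinuity ⇒ convergence on all of `⁰𝒮` (`tendsto_qcdLatticeDist_of_tensor`, `stub_offDiagonalTensorDensity`);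
Hahn–Banach limit family (`exists_labelled_tendsto`); inheritance of E0, E0′, E3 (exact `stub_permExact`), translations
and the hypercubic remnant by uniqueness of limits; the lattice gap, AF, the physical branch and chirality at zero are
read off LCR; non-triviality from the calibration and the calibrated one-point subtraction, non-Gaussianity from the
`κ₃` floor (the S-level versions of the landed `stub_speciesPackaging`, re-proved here because X₁'s `S` carries no OS
axioms).

References: Osterwalder–Schrader II (CMP 42, 1975) §4; Glimm–Jaffe 1987 §6.1; Montvay–Münster 1994 §1.7, §4.2, §5.1;
Balaban–O'Carroll–Schor (CMP 122, 1989); Brydges–Fröhlich–Seiler (CMP 71/79, 1980/81) for the solved `d = 2` sibling.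
-/

noncomputable section

namespace Summit.QuantumFields.QCD.Cruxes.HonestLatticeLimit.LadderBridge

open scoped BigOperators Topology SchwartzMap ComplexConjugate
open MeasureTheory Filter
open Literature.MathematicalPhysics.AQFT Literature.MathematicalPhysics.QuantumLattice
  Literature.MathematicalPhysics.QuantumFieldTheory
open Summit.QuantumFields.QCD.Cruxes.StableActionBridge.Sketch
open Summit.QuantumFields.QCD.Cruxes.RotationRestoration.Birth.LatticeInvariancePassesToLimit
  (isOffDiagonal_linActMulti)

/-! ## §1 The stubs -/

/-- (LCR) **the ladder is Cauchy, gapped, calibrated and chiral at zero** — OPEN, SHARED: verbatim the crux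
`Summit.QuantumFields.QCD.Theses.GapBuysCauchyRate.LadderCauchyRate` (item stmt-QuantumFields-17307, rank 2 of route
`route-QuantumFields-GapBuysCauchyRate`; one proof serves both — see `ladderCauchyRateStmt_iff`).  Why plausibly true:
it is the typed deliverable of a Bałaban–O'Carroll–Schor one-octave step with Wilson quarks tuned onto the chiral line;
why it might fail: no such step exists in print even for YM₄, and the chiral clause needs massless `N_f = 2,3` QCD
gapless.  Size XL (open problem). -/
def LadderCauchyRateStmt : Prop :=
  ∀ Nf : ℕ, Nf = 2 ∨ Nf = 3 → ∃ reg : QCDRegularisation Nf, reg.HasMassScaling ∧ (reg.scheme 0 0 0).HasAsymptoticScaling ∧ ∃ (𝒞 : CalibratedSpeciesFamily reg) (r : ℕ → ℝ), (Summable r ∧ reg.IsChiralAtZero) ∧ ∀ m : Fin Nf → ℝ, (∀ f, 0 < m f) → (∀ fl : Fin Nf, ∀ᶠ k in Filter.atTop, -1 < (𝒞.scheme m).mq fl k) ∧ (∃ Δ > 0, (𝒞.scheme m).HasLatticeMassGap Δ) ∧ (∀ᶠ k in Filter.atTop, (𝒞.scheme m).twoPoint k QCDField.glue QCDField.glue (thetaTest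 4 𝒞.f₀) 𝒞.f₀ = 1) ∧ (∀ f g : Fin Nf, f ≠ g → ∀ᶠ k in Filter.atTop, (𝒞.scheme m).twoPoint k (QCDField.pseudoRe f g) (QCDField.pseudoRe f g) (thetaTest 4 𝒞.f₀) 𝒞.f₀ = 1) ∧ (∃ f g h : SchwartzMap (EuclideanSpace ℝ (Fin 4)) ℝ, tsupport (f : EuclideanSpace ℝ (Fin 4) → ℝ) ⊆ {x | x 0 < 0} ∧ tsupport (g : EuclideanSpace ℝ (Fin 4) → ℝ) ⊆ {x | 0 < x 0 ∧ x 0 < 1} ∧ tsupport (h : EuclideanSpace ℝ (Fin 4) → ℝ) ⊆ {x | 1 < x 0} ∧ ∃ ε > (0 : ℝ), ∀ᶠ k in Filter.atTop, ε ≤ ‖qcdLatticeSchwinger (𝒞.scheme m) k 3 ![QCDField.glue, QCDField.glue, QCDField.glue] ![f, g, h] - qcdLatticeSchwinger (𝒞.scheme m) k 1 ![QCDField.glue] ![f] * qcdLatticeSchwinger (𝒞.scheme m) k 2 ![QCDField.glue, QCDField.glue] ![g, h] - qcdLatticeSchwinger (𝒞.scheme m) k 1 ![QCDField.glue] ![g]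 * qcdLatticeSchwinger (𝒞.scheme m) k 2 ![QCDField.glue, QCDField.glue] ![f, h] - qcdLatticeSchwinger (𝒞.scheme m) k 1 ![QCDField.glue] ![h] * qcdLatticeSchwinger (𝒞.scheme m) k 2 ![QCDField.glue, QCDField.glue] ![f, g] + 2 * (qcdLatticeSchwinger (𝒞.scheme m) k 1 ![QCDField.glue] ![f] * qcdLatticeSchwinger (𝒞.scheme m) k 1 ![QCDField.glue] ![g] * qcdLatticeSchwinger (𝒞.scheme m) k 1 ![QCDField.glue] ![h])‖) ∧ ∀ n : ℕ, n ≠ 0 → ∀ (σ : Fin n → QCDField Nf) (f : Fin n → SchwartzMap (EuclideanSpace ℝ (Fin 4)) ℝ) (F : SchwartzMap (Fin n → EuclideanSpace ℝ (Fin 4)) ℂ), IsTensorOf F (fun i => ofRealTest (f i)) → IsOffDiagonal F → ∃ C : ℝ, ∀ k : ℕ, ‖qcdLatticeSchwinger (𝒞.scheme m) (k + 1) n σ f - qcdLatticeSchwinger (𝒞.scheme m) k n σ f‖ ≤ C * r k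

/-- (LCR) the stub, signature inline (= `LadderCauchyRateStmt` = item stmt-QuantumFields-17307 verbatim) — OPEN, SHARED. -/
theorem stub_ladderCauchyRate :
    ∀ Nf : ℕ, Nf = 2 ∨ Nf = 3 → ∃ reg : QCDRegularisation Nf, reg.HasMassScaling ∧ (reg.scheme 0 0 0).HasAsymptoticScaling ∧ ∃ (𝒞 : CalibratedSpeciesFamily reg) (r : ℕ → ℝ), (Summable r ∧ reg.IsChiralAtZero) ∧ ∀ m : Fin Nf → ℝ, (∀ f, 0 < m f) → (∀ fl : Fin Nf, ∀ᶠ k in Filter.atTop, -1 < (𝒞.scheme m).mq fl k) ∧ (∃ Δ > 0, (𝒞.scheme m).HasLatticeMassGap Δ) ∧ (∀ᶠ k in Filter.atTop, (𝒞.scheme m).twoPoint k QCDField.glue QCDField.glue (thetaTest 4 𝒞.f₀) 𝒞.f₀ = 1) ∧ (∀ f g : Fin Nf, f ≠ g → ∀ᶠ k in Filter.atTop, (𝒞.scheme m).twoPoint k (QCDField.pseudoRe f g) (QCDField.pseudoRe f g) (thetaTest 4 𝒞.f₀) 𝒞.f₀ = 1) ∧ (∃ f g h : SchwartzMap (EuclideanSpace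 ℝ (Fin 4)) ℝ, tsupport (f : EuclideanSpace ℝ (Fin 4) → ℝ) ⊆ {x | x 0 < 0} ∧ tsupport (g : EuclideanSpace ℝ (Fin 4) → ℝ) ⊆ {x | 0 < x 0 ∧ x 0 < 1} ∧ tsupport (h : EuclideanSpace ℝ (Fin 4) → ℝ) ⊆ {x | 1 < x 0} ∧ ∃ ε > (0 : ℝ), ∀ᶠ k in Filter.atTop, ε ≤ ‖qcdLatticeSchwinger (𝒞.scheme m) k 3 ![QCDField.glue, QCDField.glue, QCDField.glue] ![f, g, h] - qcdLatticeSchwinger (𝒞.scheme m) k 1 ![QCDField.glue] ![f] * qcdLatticeSchwinger (𝒞.scheme m) k 2 ![QCDField.glue, QCDField.glue] ![g, h] - qcdLatticeSchwinger (𝒞.scheme m) k 1 ![QCDField.glue] ![g] * qcdLatticeSchwinger (𝒞.scheme m) k 2 ![QCDField.glue, QCDField.glue] ![f, h] - qcdLatticeSchwinger (𝒞.scheme m) k 1 ![QCDField.glue] ![h] * qcdLatticeSchwinger (𝒞.scheme m) k 2 ![QCDField.glue, QCDField.glue] ![f, g] + 2 * (qcdLatticeSchwinger (𝒞.scheme m)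 k 1 ![QCDField.glue] ![f] * qcdLatticeSchwinger (𝒞.scheme m) k 1 ![QCDField.glue] ![g] * qcdLatticeSchwinger (𝒞.scheme m) k 1 ![QCDField.glue] ![h])‖) ∧ ∀ n : ℕ, n ≠ 0 → ∀ (σ : Fin n → QCDField Nf) (f : Fin n → SchwartzMap (EuclideanSpace ℝ (Fin 4)) ℝ) (F : SchwartzMap (Fin n → EuclideanSpace ℝ (Fin 4)) ℂ), IsTensorOf F (fun i => ofRealTest (f i)) → IsOffDiagonal F → ∃ C : ℝ, ∀ k : ℕ, ‖qcdLatticeSchwinger (𝒞.scheme m) (k + 1) n σ f - qcdLatticeSchwinger (𝒞.scheme m) k n σ f‖ ≤ C * r k := by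
  sorry

example : LadderCauchyRateStmt := stub_ladderCauchyRate

/-- The LCR stub IS the sibling crux, literally. -/
theorem ladderCauchyRateStmt_iff :
    LadderCauchyRateStmt ↔ Summit.QuantumFields.QCD.Theses.GapBuysCauchyRate.LadderCauchyRate :=
  Iff.rfl

/-- (T) **calibrated tightness** — OPEN, SHARED: verbatim the registered stub `stub_tightness` of the sibling crux
`ConvergentOSClosure` (stmt-QuantumFields-11525): along a convergent, calibrated, gapped, asymptotically free ladder the
canonical lattice distributions obey ONE k-uniform E0′ bound on `⁰𝒮`.  Why plausibly true: asymptotic freedom makes the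
short-distance singularities of the renormalised composite fields polynomial, and test functions in `⁰𝒮` vanish to
infinite order on the diagonals; why it might fail: it is the k-uniform UV output nobody has built (Bałaban's UV
stability controls effective actions, not smeared Schwinger functions).  Size XL. -/
def CalibratedTightnessStmt : Prop :=
    ∀ (Nf : ℕ) (reg : QCDRegularisation Nf) (𝒞 : CalibratedSpeciesFamily reg) (m : Fin Nf → ℝ),
    (∀ f, 0 < m f) → (𝒞.scheme m).HasAsymptoticScaling →
    (∀ fl : Fin Nf, ∀ᶠ k in Filter.atTop, -1 < (𝒞.scheme m).mq fl k) →
    (∃ Δ > 0, (𝒞.scheme m).HasLatticeMassGap Δ) →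
    (∀ᶠ k in Filter.atTop,
      (𝒞.scheme m).twoPoint k QCDField.glue QCDField.glue (thetaTest 4 𝒞.f₀) 𝒞.f₀ = 1) →
    (∀ f g : Fin Nf, f ≠ g → ∀ᶠ k in Filter.atTop,
      (𝒞.scheme m).twoPoint k (QCDField.pseudoRe f g) (QCDField.pseudoRe f g)
        (thetaTest 4 𝒞.f₀) 𝒞.f₀ = 1) →
    (∀ n : ℕ, n ≠ 0 → ∀ (σ : Fin n → QCDField Nf)
      (f : Fin n → SchwartzMap (EuclideanSpace ℝ (Fin 4)) ℝ) (F : SchwartzMap (Fin n → EuclideanSpace ℝ (Fin 4)) ℂ),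
      IsTensorOf F (fun i => ofRealTest (f i)) → IsOffDiagonal F →
        ∃ c : ℂ, Filter.Tendsto (fun k : ℕ => qcdLatticeSchwinger (𝒞.scheme m) k n σ f)
          Filter.atTop (nhds c)) →
    ∃ (s : ℕ) (α β : ℝ), 0 ≤ α ∧
      (∀ (n : ℕ) (σ : Fin n → QCDField Nf), ∀ᶠ k in Filter.atTop,
        ∀ F : SchwartzMap (Fin n → EuclideanSpace ℝ (Fin 4)) ℂ, IsOffDiagonal F →
          ‖qcdLatticeDist (𝒞.scheme m) k n σ F‖ ≤ α * (n.factorial : ℝ) ^ β * schwartzNorm (n * s) F)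

/-- (T) the stub, signature inline (= `CalibratedTightnessStmt`, verbatim the registered `stub_tightness` of
`Cruxes/ConvergentOSClosure/Lines/registered.lean`, item stmt-QuantumFields-11525) — OPEN, SHARED. -/
theorem stub_calibratedTightness :
    ∀ (Nf : ℕ) (reg : QCDRegularisation Nf) (𝒞 : CalibratedSpeciesFamily reg) (m : Fin Nf → ℝ),
    (∀ f, 0 < m f) → (𝒞.scheme m).HasAsymptoticScaling →
    (∀ fl : Fin Nf, ∀ᶠ k in Filter.atTop, -1 < (𝒞.scheme m).mq fl k) →
    (∃ Δ > 0, (𝒞.scheme m).HasLatticeMassGap Δ) →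
    (∀ᶠ k in Filter.atTop,
      (𝒞.scheme m).twoPoint k QCDField.glue QCDField.glue (thetaTest 4 𝒞.f₀) 𝒞.f₀ = 1) →
    (∀ f g : Fin Nf, f ≠ g → ∀ᶠ k in Filter.atTop,
      (𝒞.scheme m).twoPoint k (QCDField.pseudoRe f g) (QCDField.pseudoRe f g)
        (thetaTest 4 𝒞.f₀) 𝒞.f₀ = 1) →
    (∀ n : ℕ, n ≠ 0 → ∀ (σ : Fin n → QCDField Nf)
      (f : Fin n → SchwartzMap (EuclideanSpace ℝ (Fin 4)) ℝ) (F : SchwartzMap (Fin n → EuclideanSpace ℝ (Fin 4)) ℂ),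
      IsTensorOf F (fun i => ofRealTest (f i)) → IsOffDiagonal F →
        ∃ c : ℂ, Filter.Tendsto (fun k : ℕ => qcdLatticeSchwinger (𝒞.scheme m) k n σ f)
          Filter.atTop (nhds c)) →
    ∃ (s : ℕ) (α β : ℝ), 0 ≤ α ∧
      (∀ (n : ℕ) (σ : Fin n → QCDField Nf), ∀ᶠ k in Filter.atTop,
        ∀ F : SchwartzMap (Fin n → EuclideanSpace ℝ (Fin 4)) ℂ, IsOffDiagonal F →
          ‖qcdLatticeDist (𝒞.scheme m) k n σ F‖ ≤ α * (n.factorial : ℝ) ^ β * schwartzNorm (n * s) F) := by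
  sorry

example : CalibratedTightnessStmt := stub_calibratedTightness

/-- (HYP) **the discrete remnant: asymptotic invariance under proper signed axis permutations** — NEW (provable with
work, size L).  Along the same ladder and GIVEN the k-uniform E0′ bound, for every linear isometry `R` of `ℝ⁴` of
determinant one mapping each coordinate axis to a signed coordinate axis,
`Λ_k(F ∘ R⁻¹) − Λ_k(F) → 0` for every `F ∈ ⁰𝒮`, `Λ_k = qcdLatticeDist (𝒞.scheme m) k`.  Expected proof: (i) extend the
tree's axis-permutation covariance of the honest functional (`qcdTorusExpect_quarkAxisPerm`, spinor intertwiners) to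
axis reflections (`x_μ ↦ −x_μ`, spinor `γ_μγ₅`, links `U_μ(x) ↦ U_μ(Px − μ̂)⁻¹`; the centred box `{−L,…,L}⁴` and the Wilson
and Haar measures are invariant; the Berezin Jacobian is `1`); for `det R = 1` the composite spinor matrix commutes
with `γ₅`, so `pseudoRe/pseudoIm` insertions are exactly covariant, while the forward-plaquette glue density is carried
to a density displaced by one lattice unit in the reflected directions; (ii) the displacement costs
`‖F − F(· + a_k δ)‖` in a Schwartz norm, killed by the E0′ equicontinuity as `a_k → 0` — the argument of the landed
`stub_asymptoticTranslation`; the plane-resolved glue pieces need the same k-uniform bound plane by plane (obtain it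
inside the proof from the exact permutation symmetry and the hypotheses, or thread it from the UV input of T).  Why it
might fail as typed: only through that plane-resolved bound — the statement itself is parity invariance of lattice QCD,
exact up to `O(a_k)` bookkeeping. -/
def DiscreteRemnantStmt : Prop :=
    ∀ (Nf : ℕ) (reg : QCDRegularisation Nf) (𝒞 : CalibratedSpeciesFamily reg) (m : Fin Nf → ℝ),
    (∀ f, 0 < m f) → (𝒞.scheme m).HasAsymptoticScaling →
    (∀ fl : Fin Nf, ∀ᶠ k in Filter.atTop, -1 < (𝒞.scheme m).mq fl k) →
    (∃ Δ > 0, (𝒞.scheme m).HasLatticeMassGap Δ) →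
    (∀ᶠ k in Filter.atTop,
      (𝒞.scheme m).twoPoint k QCDField.glue QCDField.glue (thetaTest 4 𝒞.f₀) 𝒞.f₀ = 1) →
    (∀ f g : Fin Nf, f ≠ g → ∀ᶠ k in Filter.atTop,
      (𝒞.scheme m).twoPoint k (QCDField.pseudoRe f g) (QCDField.pseudoRe f g)
        (thetaTest 4 𝒞.f₀) 𝒞.f₀ = 1) →
    (∀ n : ℕ, n ≠ 0 → ∀ (σ : Fin n → QCDField Nf)
      (f : Fin n → SchwartzMap (EuclideanSpace ℝ (Fin 4)) ℝ) (F : SchwartzMap (Fin n → EuclideanSpace ℝ (Fin 4)) ℂ),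
      IsTensorOf F (fun i => ofRealTest (f i)) → IsOffDiagonal F →
        ∃ c : ℂ, Filter.Tendsto (fun k : ℕ => qcdLatticeSchwinger (𝒞.scheme m) k n σ f)
          Filter.atTop (nhds c)) →
    ∀ (s : ℕ) (α β : ℝ), 0 ≤ α →
      (∀ (n : ℕ) (σ : Fin n → QCDField Nf), ∀ᶠ k in Filter.atTop,
        ∀ F : SchwartzMap (Fin n → EuclideanSpace ℝ (Fin 4)) ℂ, IsOffDiagonal F →
          ‖qcdLatticeDist (𝒞.scheme m) k n σ F‖ ≤ α * (n.factorial : ℝ) ^ β * schwartzNorm (n * s) F) →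
    (∀ (n : ℕ) (σ : Fin n → QCDField Nf) (R : EuclideanSpace ℝ (Fin 4) ≃ₗᵢ[ℝ] EuclideanSpace ℝ (Fin 4)),
      LinearMap.det (R.toLinearEquiv : EuclideanSpace ℝ (Fin 4) →ₗ[ℝ] EuclideanSpace ℝ (Fin 4)) = 1 →
      (∀ i : Fin 4, ∃ j : Fin 4, R (EuclideanSpace.single i 1) = EuclideanSpace.single j 1 ∨
        R (EuclideanSpace.single i 1) = -EuclideanSpace.single j 1) →
      ∀ F : SchwartzMap (Fin n → EuclideanSpace ℝ (Fin 4)) ℂ, IsOffDiagonal F →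
        Filter.Tendsto (fun k : ℕ => qcdLatticeDist (𝒞.scheme m) k n σ (linActMulti R F) -
          qcdLatticeDist (𝒞.scheme m) k n σ F) Filter.atTop (nhds 0))

/-- (HYP) the stub, signature inline (= `DiscreteRemnantStmt`) — NEW, provable with work (size L). -/
theorem stub_discreteRemnant :
    ∀ (Nf : ℕ) (reg : QCDRegularisation Nf) (𝒞 : CalibratedSpeciesFamily reg) (m : Fin Nf → ℝ),
    (∀ f, 0 < m f) → (𝒞.scheme m).HasAsymptoticScaling →
    (∀ fl : Fin Nf, ∀ᶠ k in Filter.atTop, -1 < (𝒞.scheme m).mq fl k) →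
    (∃ Δ > 0, (𝒞.scheme m).HasLatticeMassGap Δ) →
    (∀ᶠ k in Filter.atTop,
      (𝒞.scheme m).twoPoint k QCDField.glue QCDField.glue (thetaTest 4 𝒞.f₀) 𝒞.f₀ = 1) →
    (∀ f g : Fin Nf, f ≠ g → ∀ᶠ k in Filter.atTop,
      (𝒞.scheme m).twoPoint k (QCDField.pseudoRe f g) (QCDField.pseudoRe f g)
        (thetaTest 4 𝒞.f₀) 𝒞.f₀ = 1) →
    (∀ n : ℕ, n ≠ 0 → ∀ (σ : Fin n → QCDField Nf)
      (f : Fin n → SchwartzMap (EuclideanSpace ℝ (Fin 4)) ℝ) (F : SchwartzMap (Fin n → EuclideanSpace ℝ (Fin 4)) ℂ),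
      IsTensorOf F (fun i => ofRealTest (f i)) → IsOffDiagonal F →
        ∃ c : ℂ, Filter.Tendsto (fun k : ℕ => qcdLatticeSchwinger (𝒞.scheme m) k n σ f)
          Filter.atTop (nhds c)) →
    ∀ (s : ℕ) (α β : ℝ), 0 ≤ α →
      (∀ (n : ℕ) (σ : Fin n → QCDField Nf), ∀ᶠ k in Filter.atTop,
        ∀ F : SchwartzMap (Fin n → EuclideanSpace ℝ (Fin 4)) ℂ, IsOffDiagonal F →
          ‖qcdLatticeDist (𝒞.scheme m) k n σ F‖ ≤ α * (n.factorial : ℝ) ^ β * schwartzNorm (n * s) F) →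
    (∀ (n : ℕ) (σ : Fin n → QCDField Nf) (R : EuclideanSpace ℝ (Fin 4) ≃ₗᵢ[ℝ] EuclideanSpace ℝ (Fin 4)),
      LinearMap.det (R.toLinearEquiv : EuclideanSpace ℝ (Fin 4) →ₗ[ℝ] EuclideanSpace ℝ (Fin 4)) = 1 →
      (∀ i : Fin 4, ∃ j : Fin 4, R (EuclideanSpace.single i 1) = EuclideanSpace.single j 1 ∨
        R (EuclideanSpace.single i 1) = -EuclideanSpace.single j 1) →
      ∀ F : SchwartzMap (Fin n → EuclideanSpace ℝ (Fin 4)) ℂ, IsOffDiagonal F →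
        Filter.Tendsto (fun k : ℕ => qcdLatticeDist (𝒞.scheme m) k n σ (linActMulti R F) -
          qcdLatticeDist (𝒞.scheme m) k n σ F) Filter.atTop (nhds 0)) := by
  sorry

example : DiscreteRemnantStmt := stub_discreteRemnant

/-! ### Name-keyed aliases of the three statements (hypotheses of the compositions) -/
namespace Registered

/-- Alias of `LadderCauchyRateStmt` keyed by the registered stub name. -/
abbrev stub_ladderCauchyRate : Prop := LadderCauchyRateStmt
/-- Alias of `CalibratedTightnessStmt` keyed by the registered stub name. -/
abbrev stub_calibratedTightness : Prop := CalibratedTightnessStmt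
/-- Alias of `DiscreteRemnantStmt` keyed by the registered stub name. -/
abbrev stub_discreteRemnant : Prop := DiscreteRemnantStmt

end Registered

/-! ## §2 Tools for the composition (all proved; S-level versions of the landed packaging lemmas) -/

/-- `ℝ⁴` (file-local notation). -/
local notation "E4" => EuclideanSpace ℝ (Fin 4)

/-- A point of the support of the tensor `⊗ᵢ fᵢ` of real test functions has every coordinate in the support of the
corresponding factor. -/
private theorem mem_tsupport_factor {n : ℕ} (f : Fin n → 𝓢(E4, ℝ)) {x : Fin n → E4}
    (hx : x ∈ tsupport ((SchwartzMap.tensorFin n fun i => ofRealTest (f i)) : (Fin n → E4) → ℂ))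
    (i : Fin n) : x i ∈ tsupport (f i : E4 → ℝ) := by
  by_contra hi
  have h1 : ∀ᶠ y in 𝓝 x, f i (y i) = 0 :=
    ((continuous_apply i).tendsto x).eventually (notMem_tsupport_iff_eventuallyEq.mp hi)
  refine (notMem_tsupport_iff_eventuallyEq.mpr ?_) hx
  filter_upwards [h1] with y hy
  simp only [Pi.zero_apply, SchwartzMap.tensorFin_apply, ofRealTest_apply]
  exact Finset.prod_eq_zero (Finset.mem_univ i) (by rw [hy]; simp)

/-- Support criterion for tensors: pairwise disjoint supports ⇒ `⊗ᵢ fᵢ ∈ ⁰𝒮`. -/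
private theorem isOffDiagonal_tensorFin {n : ℕ} (f : Fin n → 𝓢(E4, ℝ))
    (hsep : ∀ i j, i ≠ j → ∀ z, z ∈ tsupport (f i : E4 → ℝ) → z ∈ tsupport (f j : E4 → ℝ) → False) :
    IsOffDiagonal (SchwartzMap.tensorFin n fun i => ofRealTest (f i)) :=
  IsOffDiagonal.of_tsupport_subset fun x hx hmem => by
    obtain ⟨i, j, hij, hxij⟩ := hmem
    exact hsep i j hij (x i) (mem_tsupport_factor f hx i) (hxij ▸ mem_tsupport_factor f hx j)

/-- A one-fold tensor is off-diagonal (there are no pairs of distinct indices). -/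
private theorem isOffDiagonal_tensorFin_one (a : 𝓢(E4, ℝ)) :
    IsOffDiagonal (SchwartzMap.tensorFin 1 fun i => ofRealTest ((![a] : Fin 1 → _) i)) :=
  isOffDiagonal_tensorFin ![a] fun i j hij _ _ _ => hij (Subsingleton.elim i j)

/-- A two-fold tensor of real test functions with disjoint supports is off-diagonal. -/
private theorem isOffDiagonal_tensorFin_two (a b : 𝓢(E4, ℝ))
    (hab : ∀ z, z ∈ tsupport (a : E4 → ℝ) → z ∈ tsupport (b : E4 → ℝ) → False) :
    IsOffDiagonal (SchwartzMap.tensorFin 2 fun i => ofRealTest ((![a, b] : Fin 2 → _) i)) := by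
  refine isOffDiagonal_tensorFin ![a, b] fun i j hij z hzi hzj => ?_
  fin_cases i <;> fin_cases j
  · exact hij rfl
  · exact hab z hzi hzj
  · exact hab z hzj hzi
  · exact hij rfl

/-- A one-fold tensor supported in `{x⁰ > 0}` is time-ordered. -/
private theorem isTimeOrdered_tensorFin_one (g : 𝓢(E4, ℝ)) (hg : tsupport (g : E4 → ℝ) ⊆ {x | 0 < x 0}) :
    IsTimeOrdered (SchwartzMap.tensorFin 1 fun i => ofRealTest ((![g] : Fin 1 → _) i)) := by
  intro x hx
  refine ⟨fun i => ?_, fun i j hij => absurd (Fin.lt_def.mp hij) (by omega)⟩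
  have h := mem_tsupport_factor ![g] hx i
  simp only [Matrix.cons_val_fin_one] at h
  exact hg h

/-- The OS adjoint of the one-fold tensor of `Θa` is the one-fold tensor of `a` (real test functions). -/
private theorem osAdjoint_tensorFin_one_thetaTest (a : 𝓢(E4, ℝ)) :
    osAdjoint (SchwartzMap.tensorFin 1 fun i => ofRealTest ((![thetaTest 4 a] : Fin 1 → _) i)) =
      SchwartzMap.tensorFin 1 fun i => ofRealTest ((![a] : Fin 1 → _) i) := by
  ext x
  rw [osAdjoint_apply]
  simp [SchwartzMap.tensorFin_apply, thetaTest_apply, timeReflection_timeReflection]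

/-- The OS adjoint of the one-fold tensor of `a` is the one-fold tensor of `Θa` (real test functions). -/
private theorem osAdjoint_tensorFin_one (a : 𝓢(E4, ℝ)) :
    osAdjoint (SchwartzMap.tensorFin 1 fun i => ofRealTest ((![a] : Fin 1 → _) i)) =
      SchwartzMap.tensorFin 1 fun i => ofRealTest ((![thetaTest 4 a] : Fin 1 → _) i) := by
  have h := osAdjoint_tensorFin_one_thetaTest (thetaTest 4 a)
  rwa [thetaTest_involutive 4 a] at h

/-- `a ⊗ b` is the append-tensor of the one-fold tensors of `a` and `b`. -/
private theorem isAppendTensorOf_tensorFin_two (a b : 𝓢(E4, ℝ)) :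
    IsAppendTensorOf (n := 1) (m := 1)
      (SchwartzMap.tensorFin 2 fun i => ofRealTest ((![a, b] : Fin 2 → _) i))
      (SchwartzMap.tensorFin 1 fun i => ofRealTest ((![a] : Fin 1 → _) i))
      (SchwartzMap.tensorFin 1 fun i => ofRealTest ((![b] : Fin 1 → _) i)) := by
  intro x
  simp [SchwartzMap.tensorFin_apply, Fin.prod_univ_two]

/-- `![s]` is the constant label vector. -/
private theorem vec_one_eq_const {ι : Type} (s : ι) : (![s] : Fin 1 → ι) = fun _ => s := by
  funext i; fin_cases i; rfl

/-- `![s, s]` is the constant label vector. -/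
private theorem vec_two_eq_const {ι : Type} (s : ι) : (![s, s] : Fin 2 → ι) = fun _ => s := by
  funext i; fin_cases i <;> rfl

/-- `![s, s, s]` is the constant label vector. -/
private theorem vec_three_eq_const {ι : Type} (s : ι) : (![s, s, s] : Fin 3 → ι) = fun _ => s := by
  funext i; fin_cases i <;> rfl

/-- **Non-triviality at the level of the limit family `S` (no OS axioms needed)**: if the calibrating two-point
function of species `s` is eventually `1` and `S` is the limit of the calibrated lattice `n`-point functions on real
tensors in `⁰𝒮`, then `S₂^{ss}(Θf₀ ⊗ f₀) = 1 ≠ 0 = S₁^{s}(Θf₀) S₁^{s}(f₀)` — the `NT` clause of `HonestLatticeLimit`. -/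
theorem nt_of_calibration {Nf : ℕ} {reg : QCDRegularisation Nf}
    (𝒞 : CalibratedSpeciesFamily reg) (m : Fin Nf → ℝ) (s : QCDField Nf)
    (hcal : ∀ᶠ k in Filter.atTop, (𝒞.scheme m).twoPoint k s s (thetaTest 4 𝒞.f₀) 𝒞.f₀ = 1)
    (S : LabelledSchwingerFamily (QCDField Nf) E4)
    (hlim : ∀ n : ℕ, n ≠ 0 → ∀ (σ : Fin n → QCDField Nf) (f : Fin n → 𝓢(E4, ℝ)) (F : 𝓢((Fin n → E4), ℂ)),
      IsTensorOf F (fun i => ofRealTest (f i)) → IsOffDiagonal F →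
        Filter.Tendsto (fun k : ℕ => qcdLatticeSchwinger (𝒞.scheme m) k n σ f) Filter.atTop (nhds (S n σ F))) :
    ∃ (F G : 𝓢((Fin 1 → E4), ℂ)) (H : 𝓢((Fin (1 + 1) → E4), ℂ)),
      IsTimeOrdered F ∧ IsTimeOrdered G ∧ IsAppendTensorOf H (osAdjoint F) G ∧
        S (1 + 1) (fun _ => s) H ≠ S 1 (fun _ => s) (osAdjoint F) * S 1 (fun _ => s) G := by
  have hpos : tsupport (𝒞.f₀ : E4 → ℝ) ⊆ {x | 0 < x 0} := fun x hx => by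
    have h := (mem_timeSlab.1 (𝒞.tsupport_f₀ hx)).1
    simp only [Set.mem_setOf_eq]
    linarith [𝒞.τ₀_pos]
  have hsep : ∀ z, z ∈ tsupport (thetaTest 4 𝒞.f₀ : E4 → ℝ) → z ∈ tsupport (𝒞.f₀ : E4 → ℝ) → False :=
    fun z h₁ h₂ => Set.disjoint_left.1 𝒞.disjoint_tsupport h₁ h₂
  have h2 : Filter.Tendsto (fun k : ℕ => qcdLatticeSchwinger (𝒞.scheme m) k 2 ![s, s] ![thetaTest 4 𝒞.f₀, 𝒞.f₀])
      Filter.atTop (nhds (S 2 ![s, s] (SchwartzMap.tensorFin 2 fun i =>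
        ofRealTest ((![thetaTest 4 𝒞.f₀, 𝒞.f₀] : Fin 2 → _) i)))) :=
    hlim 2 two_ne_zero _ _ _ (isTensorOf_tensorFin _) (isOffDiagonal_tensorFin_two _ _ hsep)
  have h2' : Filter.Tendsto (fun k : ℕ => qcdLatticeSchwinger (𝒞.scheme m) k 2 ![s, s] ![thetaTest 4 𝒞.f₀, 𝒞.f₀])
      Filter.atTop (nhds 1) :=
    tendsto_const_nhds.congr' (hcal.mono fun k hk => by
      rw [QCDScheme.twoPoint_eq] at hk
      exact hk.symm)
  have hval2 := tendsto_nhds_unique h2 h2'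
  rw [vec_two_eq_const s] at hval2
  have h1 : Filter.Tendsto (fun k : ℕ => qcdLatticeSchwinger (𝒞.scheme m) k 1 ![s] ![𝒞.f₀]) Filter.atTop
      (nhds (S 1 ![s] (SchwartzMap.tensorFin 1 fun i => ofRealTest ((![𝒞.f₀] : Fin 1 → _) i)))) :=
    hlim 1 one_ne_zero _ _ _ (isTensorOf_tensorFin _) (isOffDiagonal_tensorFin_one _)
  have h1' : Filter.Tendsto (fun k : ℕ => qcdLatticeSchwinger (𝒞.scheme m) k 1 ![s] ![𝒞.f₀]) Filter.atTop (nhds 0) := by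
    have h0 : (fun k : ℕ => qcdLatticeSchwinger (𝒞.scheme m) k 1 ![s] ![𝒞.f₀]) = fun _ => 0 := by
      funext k
      rw [vec_one_eq_const s, vec_one_eq_const 𝒞.f₀]
      exact 𝒞.onePoint_eq_zero m s k 𝒞.f₀
    rw [h0]
    exact tendsto_const_nhds
  have hval1 := tendsto_nhds_unique h1 h1'
  rw [vec_one_eq_const s] at hval1
  refine ⟨SchwartzMap.tensorFin 1 fun i => ofRealTest ((![𝒞.f₀] : Fin 1 → _) i),
    SchwartzMap.tensorFin 1 fun i => ofRealTest ((![𝒞.f₀] : Fin 1 → _) i),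
    SchwartzMap.tensorFin 2 fun i => ofRealTest ((![thetaTest 4 𝒞.f₀, 𝒞.f₀] : Fin 2 → _) i),
    isTimeOrdered_tensorFin_one _ hpos, isTimeOrdered_tensorFin_one _ hpos, ?_, ?_⟩
  · rw [osAdjoint_tensorFin_one]
    exact isAppendTensorOf_tensorFin_two _ _
  · rw [osAdjoint_tensorFin_one]
    change S 2 (fun _ => s) _ ≠ S 1 (fun _ => s) _ * S 1 (fun _ => s) _
    rw [hval2, hval1, mul_zero]
    exact one_ne_zero

/-- **Non-Gaussianity at the level of the limit family `S`** from the lattice `κ₃` witness of species `s` (real bumps in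
the pairwise disjoint slabs `x⁰ < 0`, `0 < x⁰ < 1`, `1 < x⁰` whose lattice connected three-point combination stays
`≥ ε > 0` eventually) and the limit clause — the `NG` clause of `HonestLatticeLimit`. -/
theorem ng_of_kappa₃ {Nf : ℕ} (sch : QCDScheme Nf) (s : QCDField Nf)
    (hw : ∃ f g h : 𝓢(E4, ℝ),
      tsupport (f : E4 → ℝ) ⊆ {x | x 0 < 0} ∧ tsupport (g : E4 → ℝ) ⊆ {x | 0 < x 0 ∧ x 0 < 1} ∧
      tsupport (h : E4 → ℝ) ⊆ {x | 1 < x 0} ∧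
      ∃ ε > (0 : ℝ), ∀ᶠ k in Filter.atTop, ε ≤ ‖qcdLatticeSchwinger sch k 3 ![s, s, s] ![f, g, h] -
        qcdLatticeSchwinger sch k 1 ![s] ![f] * qcdLatticeSchwinger sch k 2 ![s, s] ![g, h] -
        qcdLatticeSchwinger sch k 1 ![s] ![g] * qcdLatticeSchwinger sch k 2 ![s, s] ![f, h] -
        qcdLatticeSchwinger sch k 1 ![s] ![h] * qcdLatticeSchwinger sch k 2 ![s, s] ![f, g] +
        2 * (qcdLatticeSchwinger sch k 1 ![s] ![f] * qcdLatticeSchwinger sch k 1 ![s] ![g] *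
          qcdLatticeSchwinger sch k 1 ![s] ![h])‖)
    (S : LabelledSchwingerFamily (QCDField Nf) E4)
    (hlim : ∀ n : ℕ, n ≠ 0 → ∀ (σ : Fin n → QCDField Nf) (f : Fin n → 𝓢(E4, ℝ)) (F : 𝓢((Fin n → E4), ℂ)),
      IsTensorOf F (fun i => ofRealTest (f i)) → IsOffDiagonal F →
        Filter.Tendsto (fun k : ℕ => qcdLatticeSchwinger sch k n σ f) Filter.atTop (nhds (S n σ F))) :
    ∃ (f g h : 𝓢(E4, ℂ)) (Ffgh : 𝓢((Fin 3 → E4), ℂ)) (Fgh Ffh Ffg : 𝓢((Fin 2 → E4), ℂ))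
      (Ff Fg Fh : 𝓢((Fin 1 → E4), ℂ)),
      IsTensorOf Ffgh ![f, g, h] ∧ IsOffDiagonal Ffgh ∧ IsTensorOf Fgh ![g, h] ∧ IsTensorOf Ffh ![f, h] ∧
      IsTensorOf Ffg ![f, g] ∧ IsTensorOf Ff ![f] ∧ IsTensorOf Fg ![g] ∧ IsTensorOf Fh ![h] ∧
      S 3 (fun _ => s) Ffgh - S 1 (fun _ => s) Ff * S 2 (fun _ => s) Fgh - S 1 (fun _ => s) Fg * S 2 (fun _ => s) Ffh -
        S 1 (fun _ => s) Fh * S 2 (fun _ => s) Ffg +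
        2 * (S 1 (fun _ => s) Ff * S 1 (fun _ => s) Fg * S 1 (fun _ => s) Fh) ≠ 0 := by
  obtain ⟨f, g, h, hf, hg, hh, ε, hε, hev⟩ := hw
  have hsl : ∀ (a b : 𝓢(E4, ℝ)) (P Q : ℝ → Prop),
      tsupport (a : E4 → ℝ) ⊆ {x | P (x 0)} → tsupport (b : E4 → ℝ) ⊆ {x | Q (x 0)} →
      (∀ t, P t → Q t → False) → ∀ z, z ∈ tsupport (a : E4 → ℝ) → z ∈ tsupport (b : E4 → ℝ) → False :=
    fun a b P Q ha hb hPQ z h1 h2 => hPQ _ (ha h1) (hb h2)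
  have hfg := hsl f g (· < 0) (fun t => 0 < t ∧ t < 1) hf hg fun t a b => by linarith [b.1]
  have hfh := hsl f h (· < 0) (1 < ·) hf hh fun t a b => by linarith
  have hgh := hsl g h (fun t => 0 < t ∧ t < 1) (1 < ·) hg hh fun t a b => by linarith [a.2]
  have h3off : IsOffDiagonal (SchwartzMap.tensorFin 3 fun i => ofRealTest ((![f, g, h] : Fin 3 → _) i)) := by
    refine isOffDiagonal_tensorFin ![f, g, h] fun i j hij z hzi hzj => ?_
    fin_cases i <;> fin_cases j
    · exact hij rfl
    · exact hfg z hzi hzj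
    · exact hfh z hzi hzj
    · exact hfg z hzj hzi
    · exact hij rfl
    · exact hgh z hzi hzj
    · exact hfh z hzj hzi
    · exact hgh z hzj hzi
    · exact hij rfl
  have L3 : Filter.Tendsto (fun k => qcdLatticeSchwinger sch k 3 ![s, s, s] ![f, g, h]) Filter.atTop
      (nhds (S 3 ![s, s, s] (SchwartzMap.tensorFin 3 fun i => ofRealTest ((![f, g, h] : Fin 3 → _) i)))) :=
    hlim 3 (by norm_num) ![s, s, s] ![f, g, h] _ (isTensorOf_tensorFin _) h3off
  have L2 : ∀ a b : 𝓢(E4, ℝ), (∀ z, z ∈ tsupport (a : E4 → ℝ) → z ∈ tsupport (b : E4 → ℝ) → False) →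
      Filter.Tendsto (fun k => qcdLatticeSchwinger sch k 2 ![s, s] ![a, b]) Filter.atTop
        (nhds (S 2 ![s, s] (SchwartzMap.tensorFin 2 fun i => ofRealTest ((![a, b] : Fin 2 → _) i)))) :=
    fun a b hab => hlim 2 two_ne_zero ![s, s] ![a, b] _ (isTensorOf_tensorFin _) (isOffDiagonal_tensorFin_two a b hab)
  have L1 : ∀ a : 𝓢(E4, ℝ), Filter.Tendsto (fun k => qcdLatticeSchwinger sch k 1 ![s] ![a]) Filter.atTop
      (nhds (S 1 ![s] (SchwartzMap.tensorFin 1 fun i => ofRealTest ((![a] : Fin 1 → _) i)))) :=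
    fun a => hlim 1 one_ne_zero ![s] ![a] _ (isTensorOf_tensorFin _) (isOffDiagonal_tensorFin_one a)
  have hlim' := (((L3.sub ((L1 f).mul (L2 g h hgh))).sub ((L1 g).mul (L2 f h hfh))).sub
    ((L1 h).mul (L2 f g hfg))).add ((((L1 f).mul (L1 g)).mul (L1 h)).const_mul 2)
  have hle := ge_of_tendsto hlim'.norm hev
  have hne : S 3 ![s, s, s] (SchwartzMap.tensorFin 3 fun i => ofRealTest ((![f, g, h] : Fin 3 → _) i))
      - S 1 ![s] (SchwartzMap.tensorFin 1 fun i => ofRealTest ((![f] : Fin 1 → _) i)) *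
        S 2 ![s, s] (SchwartzMap.tensorFin 2 fun i => ofRealTest ((![g, h] : Fin 2 → _) i))
      - S 1 ![s] (SchwartzMap.tensorFin 1 fun i => ofRealTest ((![g] : Fin 1 → _) i)) *
        S 2 ![s, s] (SchwartzMap.tensorFin 2 fun i => ofRealTest ((![f, h] : Fin 2 → _) i))
      - S 1 ![s] (SchwartzMap.tensorFin 1 fun i => ofRealTest ((![h] : Fin 1 → _) i)) *
        S 2 ![s, s] (SchwartzMap.tensorFin 2 fun i => ofRealTest ((![f, g] : Fin 2 → _) i))
      + 2 * (S 1 ![s] (SchwartzMap.tensorFin 1 fun i => ofRealTest ((![f] : Fin 1 → _) i)) *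
          S 1 ![s] (SchwartzMap.tensorFin 1 fun i => ofRealTest ((![g] : Fin 1 → _) i)) *
          S 1 ![s] (SchwartzMap.tensorFin 1 fun i => ofRealTest ((![h] : Fin 1 → _) i))) ≠ 0 := by
    intro h0
    rw [h0, norm_zero] at hle
    linarith
  rw [vec_three_eq_const s, vec_two_eq_const s, vec_one_eq_const s] at hne
  have hT : ∀ {n : ℕ} (u : Fin n → 𝓢(E4, ℝ)) (uc : Fin n → 𝓢(E4, ℂ)), (∀ i, uc i = ofRealTest (u i)) →
      IsTensorOf (SchwartzMap.tensorFin n fun i => ofRealTest (u i)) uc := fun u uc huc x => by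
    rw [SchwartzMap.tensorFin_apply]
    exact Finset.prod_congr rfl fun i _ => by rw [huc i]
  refine ⟨ofRealTest f, ofRealTest g, ofRealTest h,
    SchwartzMap.tensorFin 3 fun i => ofRealTest ((![f, g, h] : Fin 3 → _) i),
    SchwartzMap.tensorFin 2 fun i => ofRealTest ((![g, h] : Fin 2 → _) i),
    SchwartzMap.tensorFin 2 fun i => ofRealTest ((![f, h] : Fin 2 → _) i),
    SchwartzMap.tensorFin 2 fun i => ofRealTest ((![f, g] : Fin 2 → _) i),
    SchwartzMap.tensorFin 1 fun i => ofRealTest ((![f] : Fin 1 → _) i),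
    SchwartzMap.tensorFin 1 fun i => ofRealTest ((![g] : Fin 1 → _) i),
    SchwartzMap.tensorFin 1 fun i => ofRealTest ((![h] : Fin 1 → _) i),
    hT _ _ fun i => ?_, h3off, hT _ _ fun i => ?_, hT _ _ fun i => ?_, hT _ _ fun i => ?_,
    hT _ _ fun i => ?_, hT _ _ fun i => ?_, hT _ _ fun i => ?_, ?_⟩
  all_goals first | (fin_cases i <;> rfl) | exact hne

/-! ## §3 Composition (kernel-checked; no `sorry` below this line) -/

/-- **`HonestLatticeLimit` from LCR + T + HYP** — the crux `TransparentRPWall.HonestLatticeLimit` BY NAME. -/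
theorem HonestLatticeLimit_of
    (hL : Registered.stub_ladderCauchyRate) (hT : Registered.stub_calibratedTightness)
    (hH : Registered.stub_discreteRemnant) :
    Summit.QuantumFields.QCD.Theses.TransparentRPWall.HonestLatticeLimit := by
  unfold Summit.QuantumFields.QCD.Theses.TransparentRPWall.HonestLatticeLimit
  dsimp only
  intro Nf hNf
  obtain ⟨reg, hms, hAS, 𝒞, r, ⟨hr, hchi⟩, H⟩ := hL Nf hNf
  refine ⟨reg, hms, hchi, fun m hm => ?_⟩
  obtain ⟨hbr, hgapE, hcalg, hcalp, hκ₃, hCauchy⟩ := H m hm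
  -- (1) convergence of the honest lattice `n`-point functions on off-diagonal real tensors (Cauchy + summable)
  have hLIM : ∀ n : ℕ, n ≠ 0 → ∀ (σ : Fin n → QCDField Nf) (f : Fin n → 𝓢(E4, ℝ)) (F : 𝓢((Fin n → E4), ℂ)),
      IsTensorOf F (fun i => ofRealTest (f i)) → IsOffDiagonal F →
        ∃ c : ℂ, Filter.Tendsto (fun k : ℕ => qcdLatticeSchwinger (𝒞.scheme m) k n σ f) Filter.atTop (nhds c) := by
    intro n hn σ f F hF hoff
    obtain ⟨C, hC⟩ := hCauchy n hn σ f F hF hoff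
    exact Summit.QuantumFields.QCD.Theorems.cauchySummation_proof _ r C hr hC
  -- asymptotic scaling reads only `β`, `a`
  have hASm : (𝒞.scheme m).HasAsymptoticScaling := hAS
  -- (2) tightness (stub T), asymptotic translations (landed AT), the discrete remnant (stub HYP)
  obtain ⟨s, α, β, hα, hb⟩ := hT Nf reg 𝒞 m hm hASm hbr hgapE hcalg hcalp hLIM
  have hP6 := Summit.QuantumFields.QCD.Theorems.ConvergentOSClosure.stub_asymptoticTranslation
    Nf reg 𝒞 m hm hASm hbr hgapE hcalg hcalp hLIM s α β hα hb
  have hP7 := hH Nf reg 𝒞 m hm hASm hbr hgapE hcalg hcalp hLIM s α β hα hb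
  -- (3) convergence on all of `⁰𝒮` and the limit family
  have hconv : ∀ (n : ℕ) (σ : Fin n → QCDField Nf) (F : 𝓢((Fin n → E4), ℂ)),
      IsOffDiagonal F → ∃ c : ℂ, Tendsto (fun k => qcdLatticeDist (𝒞.scheme m) k n σ F) atTop (𝓝 c) :=
    tendsto_qcdLatticeDist_of_tensor (𝒞.scheme m) stub_offDiagonalTensorDensity hb hLIM
  obtain ⟨S, hS, hSb⟩ := exists_labelled_tendsto (fun k => qcdLatticeDist (𝒞.scheme m) k)
    (fun n => α * (n.factorial : ℝ) ^ β) (fun n => n * s) (fun n => by positivity) hb hconv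
  have htensor : ∀ n : ℕ, n ≠ 0 → ∀ (σ : Fin n → QCDField Nf) (f : Fin n → 𝓢(E4, ℝ)) (F : 𝓢((Fin n → E4), ℂ)),
      IsTensorOf F (fun i => ofRealTest (f i)) → IsOffDiagonal F →
      Filter.Tendsto (fun k : ℕ => qcdLatticeSchwinger (𝒞.scheme m) k n σ f) Filter.atTop (nhds (S n σ F)) := by
    intro n hn σ f F hF hoff
    refine (hS n σ F hoff).congr' (Eventually.of_forall fun k => ?_)
    exact qcdLatticeSchwinger_eq_qcdLatticeDist (𝒞.scheme m) k n hn σ f F hF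
  -- (4) the axioms of `S`
  have h0 : S.IsNormalized :=
    isNormalized_of_labelled_tendsto hS (Eventually.of_forall fun k => isNormalized_qcdLatticeDist (𝒞.scheme m) k)
  have hE0' : S.HasLinearGrowth := hasLinearGrowth_of_labelled_bound S s α β fun n k F _ => hSb n k F
  have hE1t : ∀ (n : ℕ) (σ : Fin n → QCDField Nf) (a : E4) (F : 𝓢((Fin n → E4), ℂ)), IsOffDiagonal F →
      S n σ (translateMulti a F) = S n σ F :=
    translate_eq_of_labelled_tendsto hS hP6
  have hsymm : ∀ (n : ℕ) (σ : Fin n → QCDField Nf) (π : Equiv.Perm (Fin n)) (F : 𝓢((Fin n → E4), ℂ)),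
      IsOffDiagonal F →
      Tendsto (fun k => qcdLatticeDist (𝒞.scheme m) k n σ (permTest π F) -
        qcdLatticeDist (𝒞.scheme m) k n (σ ∘ π) F) atTop (𝓝 0) := by
    intro n σ π F _
    have hzero : (fun k => qcdLatticeDist (𝒞.scheme m) k n σ (permTest π F) -
        qcdLatticeDist (𝒞.scheme m) k n (σ ∘ π) F) = fun _ => 0 :=
      funext fun k => by rw [stub_permExact, sub_self]
    rw [hzero]
    exact tendsto_const_nhds
  have hE3 : S.IsSymmetric := isSymmetric_of_labelled_tendsto hS hsymm
  have hE1h : ∀ (n : ℕ) (σ : Fin n → QCDField Nf) (R : E4 ≃ₗᵢ[ℝ] E4),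
      LinearMap.det (R.toLinearEquiv : E4 →ₗ[ℝ] E4) = 1 →
      (∀ i : Fin 4, ∃ j : Fin 4, R (EuclideanSpace.single i 1) = EuclideanSpace.single j 1 ∨
        R (EuclideanSpace.single i 1) = -EuclideanSpace.single j 1) →
      ∀ F : 𝓢((Fin n → E4), ℂ), IsOffDiagonal F → S n σ (linActMulti R F) = S n σ F := by
    intro n σ R hdet hax F hF
    have hA : Tendsto (fun k => qcdLatticeDist (𝒞.scheme m) k n σ (linActMulti R F)) atTop
        (𝓝 (S n σ (linActMulti R F))) := hS n σ _ (isOffDiagonal_linActMulti R hF)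
    have hB : Tendsto (fun k => qcdLatticeDist (𝒞.scheme m) k n σ F) atTop (𝓝 (S n σ F)) := hS n σ F hF
    exact sub_eq_zero.1 (tendsto_nhds_unique (hA.sub hB) (hP7 n σ R hdet hax F hF))
  obtain ⟨Δ, hΔ, hgap⟩ := hgapE
  -- (5) the conclusion, in the crux's order
  refine ⟨𝒞.z m, 𝒞.shift m, S, ⟨⟨h0, hE0', hE3, hE1t, hE1h⟩, ⟨hASm, hbr, htensor⟩, Δ, hΔ, hgap⟩, ?_, ?_, ?_⟩
  · exact nt_of_calibration 𝒞 m _ hcalg S htensor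
  · exact ng_of_kappa₃ (𝒞.scheme m) _ hκ₃ S htensor
  · exact fun f g hfg => nt_of_calibration 𝒞 m _ (hcalp f g hfg) S htensor

/-- The same composition for the `FourMirrorsWardE1` copy of the crux (identical body). -/
theorem HonestLatticeLimit_of' (hL : Registered.stub_ladderCauchyRate) (hT : Registered.stub_calibratedTightness)
    (hH : Registered.stub_discreteRemnant) :
    Summit.QuantumFields.QCD.Theses.FourMirrorsWardE1.HonestLatticeLimit :=
  HonestLatticeLimit_of hL hT hH

/-- **The skeleton** (hypothesis-free; its `sorry`-cone is exactly the three registered stubs). -/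
theorem HonestLatticeLimit_proof : Summit.QuantumFields.QCD.Theses.TransparentRPWall.HonestLatticeLimit :=
  HonestLatticeLimit_of stub_ladderCauchyRate stub_calibratedTightness stub_discreteRemnant

/-- The skeleton for the `FourMirrorsWardE1` copy. -/
theorem HonestLatticeLimit_proof' : Summit.QuantumFields.QCD.Theses.FourMirrorsWardE1.HonestLatticeLimit :=
  HonestLatticeLimit_of' stub_ladderCauchyRate stub_calibratedTightness stub_discreteRemnant

end Summit.QuantumFields.QCD.Cruxes.HonestLatticeLimit.LadderBridge

end
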